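import Summits.HodgeConjecture.HodgeConjecture.Theorems.CyclicUnitaryPowersJacobianEigenpartsCount
import Summits.HodgeConjecture.HodgeConjecture.Theorems.CyclicUnitaryPowersDeckHodgeOfCarlsonToledo
import Summits.HodgeConjecture.HodgeConjecture.Theorems.CyclicUnitaryPowersCyclicSurfacePowersHodgeSixFacts
import Literature.AlgebraicGeometry.HodgeTheory.DiagonalSymmetryEigenHodgeNumbersAllDimensions
import Literature.AlgebraicGeometry.HodgeTheory.HodgeFiltrationModelsReductionProofs

/-!
# K1 deck-model Hodge numbers from GRIFFITHS' residue theorem: the two Carlson–Toledo facts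
# `carlsonToledo1999_finrank_eigenspace_deck_one` / `…_inf_hodgePiece` as theorems modulo
# `Griffiths1969_residueKernel_eq_jacobianIdeal`; K1 and the rung leaf modulo FIVE facts
# (route `CyclicUnitaryPowers`, items stmt-HodgeConjecture-19544 / 19543)

Prover seat `hodge-nonav-prover-Bx` (g5), cell `hodge-nonav`, 2026-08-27. Landed
`--supports stmt-HodgeConjecture-19544`; sorry-free, no definition, no new named fact. CONDITIONAL
results: every theorem takes the Griffiths residue-kernel package
`Griffiths1969_residueKernel_eq_jacobianIdeal` (Voisin II Thm. 6.10 / Cor. 6.12, file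
`DiagonalSymmetryEigenHodgeNumbers` — the SAME named fact that route `SignSymmetricPowers` consumes for
its stub `stub_signDeckHodge`) as a hypothesis. Nothing here says HC ∕ HC_AV is proved; rung F-H1
is not moved.

## What is proved

For the models `X_F = V₊(x₃^p − f) ⊂ ℙ³` of the route (`cyclicCoverForm p f`, `f ≠ 0` homogeneous of
degree `p ≥ 3`, `X_F` smooth projective; deck transformation `σ_F = diagonalAut F ha`, `x₃ ↦ ζ_p x₃`):

* `carlsonToledo1999_finrank_eigenspace_inf_hodgePiece_of_residueKernel` — **Carlson–Toledo §5**
  ("the corresponding space of numerator polynomials, taken modulo the Jacobian ideal of `P`, is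
  isomorphic via the residue map to `H^{p,q}_0(i)`"): the tree's named fact
  `carlsonToledo1999_finrank_eigenspace_inf_hodgePiece` FOLLOWS from the Griffiths package —
  the `ζ^i`-eigen-Hodge numbers (`1 ≤ i ≤ p − 1`) are `dim (S₄^k)_{ζ^i} − dim (J_F^k)_{ζ^i}`
  (`finrank_eigenspace_inf_piece_eq_of_residueKernel_of_ne_one`, the even-dimensional equivariant
  residue theorem: `ζ^i ≠ 1`) `= dim R_f^{(q+1)p−3−i}`
  (`finrank_eigenpart_sub_finrank_eigenpart_jacobianIdeal`, the algebra of `J_F = (J_f, x₃^{p−1})`).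
* `carlsonToledo1999_finrank_eigenspace_deck_one_of_residueKernel` — **Carlson–Toledo §2**
  ("`H² = ℂ·h ⊕ H²_0`, `H²_0 = ⊕_{μ≠1} H(μ)`"): the named fact
  `carlsonToledo1999_finrank_eigenspace_deck_one` FOLLOWS from the Griffiths package — every
  `σ_F`-invariant numerator lies in `J_F` (`mem_jacobianIdeal_of_mem_eigenspace_one`), so the
  invariant part of `H²(X_F)` is the line of hyperplane classes
  (`finrank_eigenspace_pull_one_eq_one_of_residueKernel`).
* `cyclicDeckHodge_of_residueKernel` — hence the registered stub `stub_cyclicDeckHodge` of K1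
  (signature VERBATIM, via the tree's seam `cyclicDeckHodge_of_carlsonToledo`).
* `veryGeneralDeckCommutatorsInHg_of_five_facts` — **crux K1 `VeryGeneralDeckCommutatorsInHg`
  modulo FIVE cited facts**: `nonempty_carlsonToledoFamily` (CT §§2,3,6,7),
  `carlsonToledo1999_unitaryReflection_zariskiDense` (CT Thm. 7.1), `cmsp_nonHodgeGenericPoints_…`
  (CDK 1995), `andre1992_algebraicMonodromy_normal_mumfordTateGroup` (André 1992) and
  `Griffiths1969_residueKernel_eq_jacobianIdeal` (Griffiths 1969 / Voisin II 6.10) — the six-fact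
  theorem `veryGeneralDeckCommutatorsInHg_of_six_facts` with the two Hodge-number facts discharged;
  `cyclicSurfacePowersHodge_of_five_facts` — the rung leaf likewise.

The Jacobian criterion for `F` is the tree's `Hartshorne1977_smoothHypersurface_jacobian_holds`
applied to the irreducible form `F` (`irreducible_cyclicCoverForm`).

## References

* [CarlsonToledo1999] J. A. Carlson, D. Toledo, Discriminant complements and kernels of monodromy
  representations, Duke Math. J. 97 (1999); arXiv alg-geom/9708002, §2 (held text p0005), §5
  (p0011–p0012).
* [VoisinHodgeII2003] C. Voisin, Hodge Theory and Complex Algebraic Geometry II, CUP 2003, §6.1.3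
  Thm. 6.10, Cor. 6.12 (held text chunks p0159, p0161).
* [Griffiths1969] P. Griffiths, On the periods of certain rational integrals I, II, Ann. of Math. 90
  (1969), §8.
-/

noncomputable section

-- mandated namespace `Summit.HodgeConjecture.HodgeConjecture.Theorems` trips `linter.dupNamespace` (off tree-wide)
set_option linter.dupNamespace false

namespace Summit.HodgeConjecture.HodgeConjecture.Theorems.CyclicUnitaryPowersDeckHodgeOfGriffiths

open scoped TensorProduct
open Literature.AlgebraicGeometry.Motives Literature.AlgebraicGeometry.HodgeTheory
open Literature.AlgebraicGeometry.HodgeTheory.BettiUniverse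
open Literature.RingTheory.MvPolynomial (idealDegree mem_idealDegree)
open Summit.HodgeConjecture.HodgeConjecture.Theorems.CyclicUnitaryPowersCyclicCoverIrreducible
  (isHomogeneous_cyclicCoverForm irreducible_cyclicCoverForm)
open Summit.HodgeConjecture.HodgeConjecture.Theorems.CyclicUnitaryPowersJacobianEigenparts
  (mem_jacobianIdeal_of_mem_eigenspace_one)
open Summit.HodgeConjecture.HodgeConjecture.Theorems.CyclicUnitaryPowersJacobianEigenpartsCount
  (finrank_eigenpart_sub_finrank_eigenpart_jacobianIdeal)
open CategoryTheory MvPolynomial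

variable {p : ℕ} {f : MvPolynomial (Fin 3) ℂ}

/-! ### §1 The Jacobian criterion for the smooth models -/

/-- For a smooth model `X_F`, `F = x₃^p − f` (`f ≠ 0`, `p ≥ 2`), the gradient of `F` vanishes at no
non-zero zero of `F` (the tree's Jacobian criterion `Hartshorne1977_smoothHypersurface_jacobian_holds`
for the irreducible form `F`). [cite: Hartshorne1977, I Thm. 5.1 and Ex. 5.8] -/
theorem exists_eval_pderiv_ne_zero (hp : 2 ≤ p) (hf : f.IsHomogeneous p) (hf0 : f ≠ 0)
    (hXF : IsSmoothProjective 2 (SmoothHypersurface.hypersurface (cyclicCoverForm p f))) :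
    ∀ z : Fin (2 + 2) → ℂ, z ≠ 0 → MvPolynomial.eval z (cyclicCoverForm p f) = 0 →
      ∃ j, MvPolynomial.eval z (MvPolynomial.pderiv j (cyclicCoverForm p f)) ≠ 0 :=
  fun z hz hFz ↦ Hartshorne1977_smoothHypersurface_jacobian_holds 2 p
    (SmoothHypersurface.hypersurface (cyclicCoverForm p f)) (cyclicCoverForm p f) hXF
    (isHomogeneous_cyclicCoverForm hf) (irreducible_cyclicCoverForm hp hf hf0 hXF)
    (SmoothHypersurface.isHypersurfaceCutOutBy_self (cyclicCoverForm p f)) z hz hFz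

/-! ### §2 Carlson–Toledo §5: the eigen-Hodge numbers, from Griffiths' residue theorem -/

/-- **Carlson–Toledo's eigen-Hodge numbers of the cyclic covers of the plane FOLLOW from Griffiths'
residue theorem**: granted `Griffiths1969_residueKernel_eq_jacobianIdeal` (Voisin II Thm. 6.10 /
Cor. 6.12), the named fact `carlsonToledo1999_finrank_eigenspace_inf_hodgePiece` holds — for
`f ≠ 0` of degree `p ≥ 3` with `X_F` smooth, `1 ≤ i ≤ p − 1`, `q ≤ 2`:
`dim (ker(σ_F^* ⊗ ℂ − ζ^i) ∩ H^{2−q,q}(X_F)) = dim R_f^{(q+1)p−3−i}` (`0` if `(q+1)p < 3+i`). The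
eigenvalue `ζ^i ≠ 1` is read off the numerators by the any-dimensional equivariant residue theorem,
and the eigen-part of the Jacobian ring of `F = x₃^p − f` is the shifted Jacobian ring of `f`.
[cite: CarlsonToledo1999, §5 (held text p0011–p0012)]
[cite: VoisinHodgeII2003, §6.1.3 Thm. 6.10 and Cor. 6.12 (held text chunks p0159, p0161)] -/
theorem carlsonToledo1999_finrank_eigenspace_inf_hodgePiece_of_residueKernel
    (hG : Griffiths1969_residueKernel_eq_jacobianIdeal) :
    carlsonToledo1999_finrank_eigenspace_inf_hodgePiece := by
  intro hHD p hp3 f hf hf0 hXF ha i q hi hip hq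
  have hp2 : 2 ≤ p := by omega
  have hF := isHomogeneous_cyclicCoverForm hf
  have hJ := exists_eval_pderiv_ne_zero hp2 hf hf0 hXF
  have hζ := Complex.isPrimitiveRoot_exp p (by omega)
  have hμ : Complex.exp (2 * (Real.pi : ℂ) * Complex.I / (p : ℂ)) ^ i ≠ 1 :=
    hζ.pow_ne_one_of_pos_of_lt (by omega) hip
  by_cases hrange : 4 ≤ (q + 1) * p
  · -- the numerator degree `k = (q+1)p − 4`
    obtain ⟨k, hk⟩ : ∃ k, k + (2 + 2) = (q + 1) * p := ⟨(q + 1) * p - 4, by omega⟩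
    have h := finrank_eigenspace_inf_piece_eq_of_residueKernel_of_ne_one (n := 2) hG hHD
      hodgePQ_independent_of_hodgeModel_holds (by omega) hF hJ hXF ha hμ hq hk
    simp only [Nat.cast_ofNat] at h
    rw [h, finrank_eigenpart_sub_finrank_eigenpart_jacobianIdeal hp2 f hi hip k]
    have hiff : k + 1 < i ↔ (q + 1) * p < 3 + i := by omega
    have hidx : k + 1 - i = (q + 1) * p - 3 - i := by omega
    rw [hidx]
    by_cases hc : (q + 1) * p < 3 + i
    · rw [if_pos hc, if_pos (hiff.mpr hc)]
    · rw [if_neg hc, if_neg fun h' ↦ hc (hiff.mp h')]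
  · -- below the Jacobian range (`p = 3`, `q = 0`: `H^{2,0} = 0`)
    have hlt : (q + 1) * p < 2 + 2 := by omega
    have h := eigenspace_inf_piece_eq_bot_of_lt_of_ne_one (n := 2)
      (Griffiths1969_residues_span_hodgeFiltration_of_residueKernel hG) hHD (by omega) hF hJ hXF ha hμ hq hlt
    simp only [Nat.cast_ofNat] at h
    rw [h, finrank_bot, if_pos (by omega)]

/-! ### §3 Carlson–Toledo §2: the invariant line, from Griffiths' residue theorem -/

/-- **Carlson–Toledo's invariant line FOLLOWS from Griffiths' residue theorem**: granted
`Griffiths1969_residueKernel_eq_jacobianIdeal`, the named fact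
`carlsonToledo1999_finrank_eigenspace_deck_one` holds — `dim_ℚ H²(X_F(ℂ); ℚ)^{σ_F^*} = 1` for every
smooth model. Every `σ_F`-invariant numerator `x^e` (`p ∣ e₃ + 1`) is a multiple of
`x₃^{p−1} = p⁻¹ ∂F/∂x₃ ∈ J_F` (`mem_jacobianIdeal_of_mem_eigenspace_one`), so the invariant part of
`H²` is the line `ι^* H²(ℙ³)` (`finrank_eigenspace_pull_one_eq_one_of_residueKernel`): in print,
"`H² = ℂ·h ⊕ H²_0`" and "`H^{n+1}(Y,ℂ)_0 = ⊕_{μ ≠ 1} H(μ)`". [cite: CarlsonToledo1999, §2 (held text p0005)]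
[cite: VoisinHodgeII2003, §6.1.3 Thm. 6.10 (held text chunk p0159)] -/
theorem carlsonToledo1999_finrank_eigenspace_deck_one_of_residueKernel
    (hG : Griffiths1969_residueKernel_eq_jacobianIdeal) :
    carlsonToledo1999_finrank_eigenspace_deck_one := by
  intro p hp3 f hf hf0 hXF ha
  have hp2 : 2 ≤ p := by omega
  exact finrank_eigenspace_pull_one_eq_one_of_residueKernel (n := 2) (m := 1) hG
    exists_isReal_hodgeModel_holds rfl (by omega) (isHomogeneous_cyclicCoverForm hf)
    (irreducible_cyclicCoverForm hp2 hf hf0 hXF) (exists_eval_pderiv_ne_zero hp2 hf hf0 hXF) hXF ha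
    fun _ _ _ _ _ _ _ hP ↦ mem_jacobianIdeal_of_mem_eigenspace_one hp2 f hP

/-! ### §4 The registered stub, K1 and the rung leaf modulo five facts -/

/- The registered `let`-prefix binds `pmul`; after `intro` it is only used through `ehn`. -/
set_option linter.unusedVariables false in
/-- **`stub_cyclicDeckHodge` (K1 line `unitary-reflection-zariski`, crux `VeryGeneralDeckCommutatorsInHg`,
registered signature VERBATIM) modulo the Griffiths residue-kernel package alone** — the tree's seam
`cyclicDeckHodge_of_carlsonToledo` fed with the two facts discharged above.
[cite: CarlsonToledo1999, §2 (held text p0005) and §5 (held text p0011–p0012)]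
[cite: VoisinHodgeII2003, §6.1.3 Thm. 6.10 and Cor. 6.12 (held text chunks p0159, p0161)] -/
theorem cyclicDeckHodge_of_residueKernel (hG : Griffiths1969_residueKernel_eq_jacobianIdeal) :
    open Literature.AlgebraicGeometry.Motives Literature.AlgebraicGeometry.HodgeTheory Literature.AlgebraicGeometry.HodgeTheory.BettiUniverse CategoryTheory.Limits in let pmul : List ℕ → List ℕ → List ℕ := fun a b => (List.range (a.length + b.length - 1)).map fun k => ((List.range (k + 1)).map fun i => a.getD i 0 * b.getD (k - i) 0).sum; let ehn : ℕ → ℕ → ℕ → ℕ := fun p j q => if (q + 1) * p < 3 + j then 0 else ((List.replicate 3 (List.replicate (p - 1) 1)).foldl pmul [1]).getD ((q + 1) * p - 3 - j) 0; ∀ ⦃p : ℕ⦄, p.Prime → 7 ≤ p → ∀ f : MvPolynomial (Fin 3) ℂ, f.IsHomogeneous p → f ≠ 0 → ∀ (hXF : IsSmoothProjective 2 (SmoothHypersurface.hypersurface (MvPolynomial.X (Fin.last 3) ^ p - MvPolynomial.rename Fin.castSucc f))) (ha : (fun i : Fin 4 => if i = Fin.last 3 then (Units.mk0 (Complex.exp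 (2 * (Real.pi : ℂ) * Complex.I / (p : ℂ))) (Complex.exp_ne_zero _)) else 1) ∈ diagonalStabilizer (MvPolynomial.X (Fin.last 3) ^ p - MvPolynomial.rename Fin.castSucc f)), Module.finrank ℚ ↥(Module.End.eigenspace (pull (diagonalAut (MvPolynomial.X (Fin.last 3) ^ p - MvPolynomial.rename Fin.castSucc f) ha) 2) 1) = 1 ∧ ∃ ζ : ℂ, IsPrimitiveRoot ζ p ∧ ∀ j q : ℕ, 1 ≤ j → j < p → q ≤ 2 → Module.finrank ℂ ↥(Module.End.eigenspace ((pull (diagonalAut (MvPolynomial.X (Fin.last 3) ^ p - MvPolynomial.rename Fin.castSucc f) ha) 2).baseChange ℂ) (ζ ^ j) ⊓ (hodge exists_isReal_hodgeModel_holds hXF 2).piece ((2 : ℤ) - q) q) = ehn p j q :=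
  CyclicUnitaryPowersDeckHodgeOfCarlsonToledo.cyclicDeckHodge_of_carlsonToledo
    (carlsonToledo1999_finrank_eigenspace_deck_one_of_residueKernel hG)
    (carlsonToledo1999_finrank_eigenspace_inf_hodgePiece_of_residueKernel hG)

/-- **Crux K1 `VeryGeneralDeckCommutatorsInHg` modulo FIVE cited facts** (was six): the universal
Carlson–Toledo family with its Picard–Lefschetz package, the Zariski density of the unitary
reflection monodromy (CT Thm. 7.1), the Cattani–Deligne–Kaplan countable algebraic cover of the
non-Hodge-generic points, André's normality of the algebraic monodromy in the Mumford–Tate group,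
and Griffiths' residue-kernel theorem — the two Carlson–Toledo Hodge-number facts being DISCHARGED
modulo the last. CONDITIONAL; nothing here says HC ∕ HC_AV is proved.
[cite: CarlsonToledo1999, §2, §5, Thm. 7.1] [cite: VoisinHodgeII2003, §6.1.3 Thm. 6.10 and Cor. 6.12] -/
theorem veryGeneralDeckCommutatorsInHg_of_five_facts
    (hCT : nonempty_carlsonToledoFamily)
    (hCTd : carlsonToledo1999_unitaryReflection_zariskiDense)
    (hCDK : cmsp_nonHodgeGenericPoints_countable_algebraic_cover)
    (hAndre : andre1992_algebraicMonodromy_normal_mumfordTateGroup)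
    (hG : Griffiths1969_residueKernel_eq_jacobianIdeal) :
    Summit.HodgeConjecture.HodgeConjecture.Theses.CyclicUnitaryPowers.VeryGeneralDeckCommutatorsInHg := by
  have hCT1 := carlsonToledo1999_finrank_eigenspace_deck_one_of_residueKernel hG
  have hCT2 := carlsonToledo1999_finrank_eigenspace_inf_hodgePiece_of_residueKernel hG
  exact CyclicUnitaryPowersKatzGKR.veryGeneralDeckCommutatorsInHg_of_six_facts @hCT @hCT1 @hCT2 @hCDK
    @hAndre @hCTd

/-- **The rung leaf `CyclicSurfacePowersHodge` modulo the same FIVE cited facts** (K1 above and the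
tree's `cyclicSurfacePowersHodge_of_veryGeneralDeckCommutatorsInHg`, which composes K1 with the
PROVED crux K2 `PowersHodgeOfDeckCommutators` and support S). CONDITIONAL; rung F-H1 not moved.
[cite: CarlsonToledo1999, §2, §5, Thm. 7.1] [cite: VoisinHodgeII2003, §6.1.3 Thm. 6.10 and Cor. 6.12] -/
theorem cyclicSurfacePowersHodge_of_five_facts
    (hCT : nonempty_carlsonToledoFamily)
    (hCTd : carlsonToledo1999_unitaryReflection_zariskiDense)
    (hCDK : cmsp_nonHodgeGenericPoints_countable_algebraic_cover)
    (hAndre : andre1992_algebraicMonodromy_normal_mumfordTateGroup)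
    (hG : Griffiths1969_residueKernel_eq_jacobianIdeal) :
    Summit.HodgeConjecture.HodgeConjecture.Theses.CyclicUnitaryPowers.CyclicSurfacePowersHodge := by
  have hK1 := veryGeneralDeckCommutatorsInHg_of_five_facts @hCT @hCTd @hCDK @hAndre @hG
  exact CyclicUnitaryPowersCyclicSurfacePowersHodge.cyclicSurfacePowersHodge_of_veryGeneralDeckCommutatorsInHg hK1

end Summit.HodgeConjecture.HodgeConjecture.Theorems.CyclicUnitaryPowersDeckHodgeOfGriffiths

end
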